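import Summits.HodgeConjecture.HodgeConjecture.Theorems.Ring2AbelianAllWeilCellsDimFive
import Summits.HodgeConjecture.HodgeConjecture.Theorems.Ring2HypothesesWeilComponentsGerm
import Summits.HodgeConjecture.HodgeConjecture.Theorems.WeilTypeLadderLocalAnchor
import Summits.HodgeConjecture.HodgeConjecture.Theorems.HeckePrymWeilHyperbolicEightfoldsSqrtMinus7OfAnchorObject
import Literature.AlgebraicGeometry.VanGeemen1994.HyperbolicOfSplitDiscriminant
import Literature.AlgebraicGeometry.HodgeTheory.WeilTypePeriodPoint
import HarnessLib

/-!
# Ring 2 · AbelianAll (ab-weil-1, gen 11, part 9) — the door-B cell node: ON-PATH lemma, the split cell,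
  door B ⟹ the variational half of the record residual, and what the local clause already forces at the anchor

research route, not a corollary; conditional on HC_CM plus one named minimal statement.
Cell line: research route conditional on HC_CM; not a corollary; Q11.4-sentence-2 already refuted in dim ≥ 3.
`HC_CM` (`Theses.RankFourFaces.CMAbelianHodge`) does not occur in this file and no open case of the Hodge
conjecture is claimed.

## What is PROVED here (0 sorry)

Part 8g filed the per-cell find-the-cycle target of door B, `HasLocallyAlgebraicWeilAnchorInClass n d δ` (one
LOCALLY ALGEBRAIC anchor in the cell `(n, d, δ)`), and the row
`weilFamilyReach_similar → HasLocallyAlgebraicWeilAnchorInClass n d δ → WeilClassesComponent n d δ`; part 8h its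
closed forms `HasLocallyAlgebraicWeilAnchorFourfoldCells` / `…AllCells`.  The cell's rules ask for an ON-PATH lemma
on every node and for the implications BETWEEN competing candidates; this file supplies them.

* §1 ON-PATH.  `weilAnchorLocalClause_of_hodgeConjecture` (under HC every fibrewise rational `(n,n)` class is
  algebraic, so the local clause holds with `U = S(ℂ)`, `q = 0`), hence
  `hasLocallyAlgebraicWeilAnchorInClass_of_hodgeConjecture` (the realisable cell is inhabited, part 8e
  `weilClassesComponent_inhabited_of_weilSign_eq`) and the closed forms `…AllCells_of_hodgeConjecture`,
  `…FourfoldCells_of_hodgeConjecture`.  So the door-B nodes are CONSEQUENCES of the summit, as required.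
* §2 THE SPLIT CELL IS hweil's NODE.  For `n, d ≥ 1`,
  `HasLocallyAlgebraicWeilAnchorInClass n d [(-1)ⁿ] ↔ HodgeTheory.HasLocallyAlgebraicWeilAnchor n d`
  (van Geemen 5.4 in the tree: hyperbolic ⟺ discriminant class `[(-1)ⁿ]`,
  `VanGeemen1994.isHyperbolicWeilType_iff_hasWeilDiscriminantNondeg_split`); in particular Markman's LOCAL secant
  statement `Markman2025_secantAnchor_locallyAlgebraic_sixfold` (unrefereed) is exactly the anchor of the split
  sixfold cells `(3, d, [-1])`.
* §3 DOOR B ⟹ THE VARIATIONAL HALF OF THE RECORD RESIDUAL.  `WeilClassesComponent n d δ` implies typer2's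
  `WeilVariationalHodgeComponent n d δ` (read the fibre class on its `δ`-chart), its germ `LocalWeilVHCAtCMComponent n d δ`
  and `AnchoredWeilFamiliesComponent n d δ` (constant family); hence so does
  `weilFamilyReach_similar ∧ HasLocallyAlgebraicWeilAnchorInClass n d δ`.  With part 8d
  (`weilClassesComponent_of_pointed_of_variational`-type rows) the two residual shapes of a cell are now RELATED:
  (reach_similar ∧ anchorInClass) ⟹ Cell ⟹ (VHC(δ) ∧ Anchored(δ)), and Cell ⟸ (N73-pointed ∧ VHC(δ)).
* §4 WHAT THE LOCAL CLAUSE ALREADY FORCES AT THE ANCHOR (necessity, for weil-2's search): applied to the CONSTANT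
  family `P ⟶ Spec ℂ`, `WeilAnchorLocalClause n d P h w` gives `q·hⁿ + w ∈ algebraicClasses P n` for some `q ∈ ℚ`,
  hence — `h` rational `(1,1)`, Lefschetz `(1,1)` + Kleiman on the abelian `P` — `w` is ALGEBRAIC ON `P`.  So a
  door-B anchor is a member of the cell with an algebraic non-zero Weil class (one class suffices: all its Weil
  classes are then algebraic) PLUS the deformation clause; the first layer is met by every CM member (Tate, part 8b
  `weilClassesComponent_holds_at_cmAnchor`), the second is the semiregularity content.

Nothing here is new mathematics: §1/§3/§4 are bookkeeping on the carriers, §2 is van Geemen 5.4 / Deligne 4.4 as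
landed by the vG seat. [cite: vanGeemen1994HodgeAV, 4.14, Lemma 5.2 and 5.4] [cite: Deligne1982HodgeCycles, Prop. 4.4
and proof of Thm. 4.8] [cite: Markman2025SecantWeil, §1.5 (preprint, unrefereed)]
-/

set_option linter.dupNamespace false

noncomputable section

open CategoryTheory
open Literature.AlgebraicGeometry Literature.AlgebraicGeometry.Motives
open Literature.AlgebraicGeometry.HodgeTheory
open Literature.AlgebraicGeometry.VanGeemen1994
open Literature.AlgebraicTopology.SingularHomology
open Summit.HodgeConjecture.HodgeConjecture.Ring2.Hypotheses
open Summit.HodgeConjecture.HodgeConjecture.Theorems (isIso_fiberι_toSpecOver' isSmoothProjectiveFamily_toSpecOver')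
open Summit.HodgeConjecture.HodgeConjecture.Theorems.HyperbolicEightfoldsSqrtMinus7.AnchorObject
  (complexBetti_map_cupPowTwo cupPowTwo_mem_algebraicClasses_abelian)

namespace Summit.HodgeConjecture.HodgeConjecture.Ring2.AbelianAll

/-! ### §1 ON-PATH: the door-B nodes follow from the Hodge conjecture -/

/-- **HC ⟹ the local clause at ANY anchor data `(P, h, w)`**: under `HodgeConjecture` every restriction `W|_{𝒳_s}`
(rational of type `(n,n)` on the smooth projective fibre) is algebraic, so the clause holds with `U = S(ℂ)` and
`q = 0` (`localClause_of_forall_mem_algebraicClasses`). [folklore] -/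
theorem weilAnchorLocalClause_of_hodgeConjecture (hHC : _root_.HodgeConjecture) (n d : ℕ) (P : AbelianVariety ℂ)
    (h : complexBetti P.X 2) (w : complexBetti P.X (2 * n)) : WeilAnchorLocalClause n d P h w := by
  intro 𝒳 S f hf _ _ _ _ _ H W _ hW s₀ _ _ _
  exact localClause_of_forall_mem_algebraicClasses f H W s₀
    (fun s => (hHC (hf.isSmoothProjective s)).2 n _ (hW s).1 (hW s).2)

/-- **ON-PATH for the per-cell door-B node**: `HodgeConjecture → HasLocallyAlgebraicWeilAnchorInClass n d δ`
(`n, d ≥ 1`).  A realisable cell (`sign δ = (-1)ⁿ`) is inhabited by a polarized Weil-type member with a non-zero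
rational `(n, n)` Weil class (part 8e), and under HC its local clause is automatic (§1). [folklore]
[cite: vanGeemen1994HodgeAV, 4.14 and 5.3] -/
theorem hasLocallyAlgebraicWeilAnchorInClass_of_hodgeConjecture (hHC : _root_.HodgeConjecture) {n d : ℕ}
    (hn : 0 < n) (hd : 0 < d) (δ : weilNormResidueGroup d) : HasLocallyAlgebraicWeilAnchorInClass n d δ := by
  intro hδ
  obtain ⟨A, φ, e, a, c, hA, -, hφ, ha, ha0, hδA, hcW, hcQ, hcH, hc0⟩ :=
    weilClassesComponent_inhabited_of_weilSign_eq hn hd hδ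
  exact ⟨A, φ, e, a, c, hA, hφ, ha, ha0, hcW, hcQ, hc0, hcH,
    weilAnchorLocalClause_of_hodgeConjecture hHC n d A _ c, hδA⟩

/-- ON-PATH, closed form: `HodgeConjecture → HasLocallyAlgebraicWeilAnchorAllCells`. [folklore] -/
theorem hasLocallyAlgebraicWeilAnchorAllCells_of_hodgeConjecture (hHC : _root_.HodgeConjecture) :
    HasLocallyAlgebraicWeilAnchorAllCells :=
  fun _ hn _ hd δ => hasLocallyAlgebraicWeilAnchorInClass_of_hodgeConjecture hHC hn hd δ

/-- ON-PATH, closed form: `HodgeConjecture → HasLocallyAlgebraicWeilAnchorFourfoldCells`. [folklore] -/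
theorem hasLocallyAlgebraicWeilAnchorFourfoldCells_of_hodgeConjecture (hHC : _root_.HodgeConjecture) :
    HasLocallyAlgebraicWeilAnchorFourfoldCells :=
  hasLocallyAlgebraicWeilAnchorFourfoldCells_of_allCells (hasLocallyAlgebraicWeilAnchorAllCells_of_hodgeConjecture hHC)

/-! ### §2 The split cell `δ = [(-1)ⁿ]` is hweil's node `HasLocallyAlgebraicWeilAnchor n d` -/

/-- **Split cell ⟹ hweil's node**: an anchor in the cell `(n, d, [(-1)ⁿ])` is HYPERBOLIC for its `K`-symmetrised
hyperplane class (van Geemen (5.4.1) ⟸ with Landherr, in the tree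
`isHyperbolicWeilType_of_hasWeilDiscriminantNondeg_split`), so it is a locally algebraic hyperbolic anchor.
[cite: vanGeemen1994HodgeAV, 5.4] [cite: Deligne1982HodgeCycles, Cor. 4.2] -/
theorem hasLocallyAlgebraicWeilAnchor_of_anchorInClass_split {n d : ℕ} (hn : 0 < n) (hd : 0 < d)
    (h : HasLocallyAlgebraicWeilAnchorInClass n d (splitDiscriminantClass n d)) :
    HasLocallyAlgebraicWeilAnchor n d := by
  obtain ⟨P, ψ₀, e, a, w, hP, hψ, ha, ha0, hwW, hwQ, hw0, hwH, hloc, hδ⟩ := h (weilSign_splitDiscriminantClass n d)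
  exact ⟨P, ψ₀, e, a, w, hP, hψ, ha, ha0,
    isHyperbolicWeilType_of_hasWeilDiscriminantNondeg_split hn hP hd hψ e ha ha0 ⟨w, hwW, hwQ, hwH, hw0⟩ hδ,
    hwW, hwQ, hw0, hloc⟩

/-- **hweil's node ⟹ split cell**: a locally algebraic HYPERBOLIC anchor lies in the cell `[(-1)ⁿ]`
(van Geemen (5.4.1) ⟹, `hasWeilDiscriminantNondeg_neg_one_pow_of_isHyperbolicWeilType`) and its Weil class is of
Hodge type `(n, n)` (hyperbolic ⟹ balanced, Deligne Prop. 4.4).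
[cite: vanGeemen1994HodgeAV, 5.4 and Lemma 5.2 (1)] [cite: Deligne1982HodgeCycles, Prop. 4.4] -/
theorem hasLocallyAlgebraicWeilAnchorInClass_split_of_localAnchor {n d : ℕ} (hn : 0 < n) (hd : 0 < d)
    (h : HasLocallyAlgebraicWeilAnchor n d) :
    HasLocallyAlgebraicWeilAnchorInClass n d (splitDiscriminantClass n d) := by
  obtain ⟨P, ψ₀, e, a, w, hP, hψ, ha, ha0, hhyp, hwW, hwQ, hw0, hloc⟩ := h
  exact fun _ => ⟨P, ψ₀, e, a, w, hP, hψ, ha, ha0, hwW, hwQ, hw0,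
    isOfHodgeType_of_mem_weilClassesOf_of_isHyperbolicWeilType hn hd hP hψ e ha ha0 hhyp hwW, hloc,
    hasWeilDiscriminantNondeg_neg_one_pow_of_isHyperbolicWeilType hn hP hd hψ e ha ha0 hhyp⟩

/-- **THE SPLIT CELL IS hweil's NODE**: for `n, d ≥ 1`,
`HasLocallyAlgebraicWeilAnchorInClass n d [(-1)ⁿ] ↔ HasLocallyAlgebraicWeilAnchor n d`.
[cite: vanGeemen1994HodgeAV, 5.4] [cite: Deligne1982HodgeCycles, Prop. 4.4 and Cor. 4.2] -/
theorem hasLocallyAlgebraicWeilAnchorInClass_split_iff {n d : ℕ} (hn : 0 < n) (hd : 0 < d) :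
    HasLocallyAlgebraicWeilAnchorInClass n d (splitDiscriminantClass n d) ↔ HasLocallyAlgebraicWeilAnchor n d :=
  ⟨hasLocallyAlgebraicWeilAnchor_of_anchorInClass_split hn hd,
    hasLocallyAlgebraicWeilAnchorInClass_split_of_localAnchor hn hd⟩

/-- **Markman's LOCAL secant statement is the anchor of the split sixfold cells**:
`Markman2025_secantAnchor_locallyAlgebraic_sixfold → ∀ d ≥ 1, HasLocallyAlgebraicWeilAnchorInClass 3 d [-1]`
(binder; source UNREFEREED, arXiv:2502.03415 §1.5 and §7.5.2). [cite: Markman2025SecantWeil, §1.5 and §7.5.2 (preprint, unrefereed)] -/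
theorem hasLocallyAlgebraicWeilAnchorInClass_split_three_of_markmanSecantAnchor
    (hM : Markman2025_secantAnchor_locallyAlgebraic_sixfold) {d : ℕ} (hd : 0 < d) :
    HasLocallyAlgebraicWeilAnchorInClass 3 d (splitDiscriminantClass 3 d) :=
  hasLocallyAlgebraicWeilAnchorInClass_split_of_localAnchor (by norm_num) hd (hM d hd)

/-- **Door B on the split sixfold cells from Markman's local statement**:
`weilFamilyReach_similar → Markman2025_secantAnchor_locallyAlgebraic_sixfold → WeilClassesComponent 3 d [-1]`
(`d ≥ 1`; both binders, the second unrefereed — the same cells are closed in print modulo Markman's Thm. 1.5.1 via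
the floor fact, part VII-B). [cite: Deligne1982HodgeCycles, proof of Thm. 4.8]
[cite: Markman2025SecantWeil, Thm. 1.5.1 and §7.5.2 (preprint, unrefereed)] -/
theorem weilClassesComponent_split_three_of_reachSimilar_of_markmanSecantAnchor (hF : weilFamilyReach_similar)
    (hM : Markman2025_secantAnchor_locallyAlgebraic_sixfold) {d : ℕ} (hd : 0 < d) :
    WeilClassesComponent 3 d (splitDiscriminantClass 3 d) :=
  weilClassesComponent_of_reachSimilar_of_anchorInClass hF (by norm_num) hd
    (hasLocallyAlgebraicWeilAnchorInClass_split_three_of_markmanSecantAnchor hM hd)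

/-! ### §3 Door B ⟹ the variational half (and the anchored half) of the record residual -/

/-- **Cell ⟹ VHC(δ)**: `WeilClassesComponent n d δ → WeilVariationalHodgeComponent n d δ`.  Along a
`(ℚ(√-d), 2n, δ)`-Weil family every fibre class `W|_{𝒳_s}` is read on its `δ`-chart `e′ : A′.X ≅ 𝒳_s` as a rational
`(n, n)` class of the Weil plane of a member `(A′, φ′, h″)` of the cell, hence algebraic by the cell statement, and
transported back (`mem_algebraicClasses_map_iff_of_iso`); the algebraic base fibre is not even used.  The `δ`-slice
of `WeilTypeLadder.weilVariationalHodgeQuadratic_of_weilClassesImaginaryQuadratic`. [folklore]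
[cite: vanGeemen1994HodgeAV, Lemma 5.2 (3)] -/
theorem weilVariationalHodgeComponent_of_weilClassesComponent {n d : ℕ} {δ : weilNormResidueGroup d}
    (h : WeilClassesComponent n d δ) : WeilVariationalHodgeComponent n d δ := by
  intro 𝒳 S f hf _ _ _ _ W hW hch _ s
  obtain ⟨A', φ', e', hA'dim, hφ', hmem, e'', a'', ha'', ha''0, hδ'⟩ := hch s
  exact (mem_algebraicClasses_map_iff_of_iso e').1
    (h A' φ' hA'dim (isSmoothProjective_of_dim_eq' hA'dim) hφ' e'' a'' ha'' ha''0 hδ' _ ((hW s).1.map _)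
      ((hW s).2.map_of_iso e') hmem)

/-- **Cell ⟹ Anchored(δ)**: `WeilClassesComponent n d δ → AnchoredWeilFamiliesComponent n d δ` — the CONSTANT family
`A.X ⟶ Spec ℂ` anchored at `A` itself (`c` algebraic by the cell statement; fibre inclusions are isomorphisms),
verbatim the construction of `anchoredWeilFamiliesComponent_of_hodgeConjecture` with HC replaced by the cell. [folklore] -/
theorem anchoredWeilFamiliesComponent_of_weilClassesComponent {n d : ℕ} {δ : weilNormResidueGroup d}
    (h : WeilClassesComponent n d δ) : AnchoredWeilFamiliesComponent n d δ := by
  intro A φ hAdim hX hφ e a haQ ha0 hδ c hcQ hcH hc _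
  have hfam : IsSmoothProjectiveFamily (toSpecOver A.X) (2 * n) := isSmoothProjectiveFamily_toSpecOver' hX
  let s : ComplexPoints (specOver ℂ ℂ) := 𝟙 (specOver ℂ ℂ)
  haveI : ∀ t : ComplexPoints (specOver ℂ ℂ), IsIso (fiberι (toSpecOver A.X) t) :=
    fun t => isIso_fiberι_toSpecOver' (X := A.X) t
  let ι : A.X ≅ fiberOver (toSpecOver A.X) s := (asIso (fiberι (toSpecOver A.X) s)).symm
  have halg : c ∈ algebraicClasses A.X n := h A φ hAdim hX hφ e a haQ ha0 hδ c hcQ hcH hc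
  have hback : ∀ t : ComplexPoints (specOver ℂ ℂ),
      complexBetti.map (asIso (fiberι (toSpecOver A.X) t)).symm.hom (2 * n)
        (complexBetti.map (fiberι (toSpecOver A.X) t) (2 * n) c) = c := fun t => by
    change (complexBetti.map (asIso (fiberι (toSpecOver A.X) t)).hom (2 * n) ≫
      complexBetti.map (asIso (fiberι (toSpecOver A.X) t)).inv (2 * n)) c = c
    rw [← complexBetti.map_comp, Iso.inv_hom_id, complexBetti.map_id]
    rfl
  refine ⟨A.X, specOver ℂ ℂ, toSpecOver A.X, s, s, ι, c, hfam,
    IsQuasiProjectiveOver.of_isProjectiveOver hX.isProjectiveOver, IsQuasiProjectiveOver.specOver,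
    inferInstanceAs (IrreducibleSpace (PrimeSpectrum ℂ)), ?_, ?_, ?_, hback s, ?_⟩
  · haveI : IsIso (specOver ℂ ℂ).hom := by rw [specOver_hom_eq_id]; exact IsIso.id _
    infer_instance
  · intro t
    exact ⟨hcQ.pullback _, IsOfHodgeType.map_of_iso (asIso (fiberι (toSpecOver A.X) t)) hcH⟩
  · intro t
    refine ⟨A, φ, (asIso (fiberι (toSpecOver A.X) t)).symm, hAdim, hφ, ?_, e, a, haQ, ha0, hδ⟩
    rw [hback t]
    exact hc
  · change complexBetti.map (fiberι (toSpecOver A.X) s) (2 * n) c ∈ algebraicClasses _ n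
    exact (mem_algebraicClasses_map_iff_of_iso (asIso (fiberι (toSpecOver A.X) s))).2 halg

/-- **Door B ⟹ VHC(δ)**: `weilFamilyReach_similar → HasLocallyAlgebraicWeilAnchorInClass n d δ →
WeilVariationalHodgeComponent n d δ` (`n, d ≥ 1`). [cite: Deligne1982HodgeCycles, proof of Thm. 4.8]
[cite: CharlesSchnell2014Notes, Conj. 11.3.1] -/
theorem weilVariationalHodgeComponent_of_reachSimilar_of_anchorInClass {n d : ℕ} {δ : weilNormResidueGroup d}
    (hF : weilFamilyReach_similar) (hn : 0 < n) (hd : 0 < d) (hP : HasLocallyAlgebraicWeilAnchorInClass n d δ) :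
    WeilVariationalHodgeComponent n d δ :=
  weilVariationalHodgeComponent_of_weilClassesComponent (weilClassesComponent_of_reachSimilar_of_anchorInClass hF hn hd hP)

/-- **Door B ⟹ the CM germ of the record residual**: `weilFamilyReach_similar → HasLocallyAlgebraicWeilAnchorInClass n d δ
→ LocalWeilVHCAtCMComponent n d δ`. [cite: Deligne1982HodgeCycles, proof of Thm. 4.8] [cite: CharlesSchnell2014Notes, Conj. 11.3.1] -/
theorem localWeilVHCAtCMComponent_of_reachSimilar_of_anchorInClass {n d : ℕ} {δ : weilNormResidueGroup d}
    (hF : weilFamilyReach_similar) (hn : 0 < n) (hd : 0 < d) (hP : HasLocallyAlgebraicWeilAnchorInClass n d δ) :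
    LocalWeilVHCAtCMComponent n d δ :=
  localWeilVHCAtCMComponent_of_weilVariationalHodgeComponent
    (weilVariationalHodgeComponent_of_reachSimilar_of_anchorInClass hF hn hd hP)

/-- **Door B ⟹ Anchored(δ)**: `weilFamilyReach_similar → HasLocallyAlgebraicWeilAnchorInClass n d δ →
AnchoredWeilFamiliesComponent n d δ`. [cite: Deligne1982HodgeCycles, proof of Thm. 4.8] -/
theorem anchoredWeilFamiliesComponent_of_reachSimilar_of_anchorInClass {n d : ℕ} {δ : weilNormResidueGroup d}
    (hF : weilFamilyReach_similar) (hn : 0 < n) (hd : 0 < d) (hP : HasLocallyAlgebraicWeilAnchorInClass n d δ) :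
    AnchoredWeilFamiliesComponent n d δ :=
  anchoredWeilFamiliesComponent_of_weilClassesComponent (weilClassesComponent_of_reachSimilar_of_anchorInClass hF hn hd hP)

/-! ### §4 Necessity: the local clause already makes the anchor's class algebraic ON THE ANCHOR -/

/-- **The local clause on the constant family**: if `(P, ψ₀)` is an abelian `2n`-fold with `ψ₀² = -d`, `h` is
rational `(1,1)` and `w` rational `(n,n)` on `P`, then `WeilAnchorLocalClause n d P h w` — applied to the constant
family `P.X ⟶ Spec ℂ` (smooth projective, quasi-projective total space and base, every fibre `≅ P.X` charted by
`(P, ψ₀)`), the global classes `H = h`, `W = w` and the chart `P.X ≅ P.X ×_{Spec ℂ} Spec ℂ` — yields `q ∈ ℚ` with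
`q·hⁿ + w ∈ algebraicClasses P n`. [folklore] -/
theorem exists_smul_cupPowTwo_add_mem_algebraicClasses_of_weilAnchorLocalClause {n d : ℕ} {P : AbelianVariety ℂ}
    {ψ₀ : P ⟶ P} (hP : P.dim = 2 * n) (hψ : ψ₀ ≫ ψ₀ = -(d • 𝟙 P)) {h : complexBetti P.X 2}
    (hhQ : IsRationalClass h) (hhH : IsOfHodgeType (2 * n) P.X 2 1 1 h) {w : complexBetti P.X (2 * n)}
    (hwQ : IsRationalClass w) (hwH : IsOfHodgeType (2 * n) P.X (2 * n) n n w)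
    (hloc : WeilAnchorLocalClause n d P h w) :
    ∃ q : ℚ, ((q : ℚ) : ℂ) • cupPowTwo h n + w ∈ algebraicClasses P.X n := by
  have hX : IsSmoothProjective (2 * n) P.X := isSmoothProjective_of_dim_eq' hP
  have hfam : IsSmoothProjectiveFamily (toSpecOver P.X) (2 * n) := isSmoothProjectiveFamily_toSpecOver' hX
  let s : ComplexPoints (specOver ℂ ℂ) := 𝟙 (specOver ℂ ℂ)
  haveI : ∀ t : ComplexPoints (specOver ℂ ℂ), IsIso (fiberι (toSpecOver P.X) t) :=
    fun t => isIso_fiberι_toSpecOver' (X := P.X) t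
  let ι : P.X ≅ fiberOver (toSpecOver P.X) s := (asIso (fiberι (toSpecOver P.X) s)).symm
  have hback : ∀ (k : ℕ) (c : complexBetti P.X k),
      complexBetti.map ι.hom k (complexBetti.map (fiberι (toSpecOver P.X) s) k c) = c := fun k c => by
    change (complexBetti.map (asIso (fiberι (toSpecOver P.X) s)).hom k ≫
      complexBetti.map (asIso (fiberι (toSpecOver P.X) s)).inv k) c = c
    rw [← complexBetti.map_comp, Iso.inv_hom_id, complexBetti.map_id]
    rfl
  have hSsm : AlgebraicGeometry.Smooth (specOver ℂ ℂ).hom := by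
    haveI : IsIso (specOver ℂ ℂ).hom := by rw [specOver_hom_eq_id]; exact IsIso.id _
    infer_instance
  obtain ⟨U, q, -, hsU, hU⟩ := hloc (toSpecOver P.X) hfam
    (IsQuasiProjectiveOver.of_isProjectiveOver hX.isProjectiveOver) IsQuasiProjectiveOver.specOver
    (inferInstanceAs (IrreducibleSpace (PrimeSpectrum ℂ))) hSsm
    (fun t => ⟨P, ψ₀, hP, hψ, ⟨(asIso (fiberι (toSpecOver P.X) t)).symm⟩⟩) h w
    (fun t => ⟨hhQ.pullback _, IsOfHodgeType.map_of_iso (asIso (fiberι (toSpecOver P.X) t)) hhH⟩)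
    (fun t => ⟨hwQ.pullback _, IsOfHodgeType.map_of_iso (asIso (fiberι (toSpecOver P.X) t)) hwH⟩)
    s ι (hback 2 h) (hback (2 * n) w)
  refine ⟨q, ?_⟩
  have hres : complexBetti.map (fiberι (toSpecOver P.X) s) (2 * n) (((q : ℚ) : ℂ) • cupPowTwo h n + w) =
      ((q : ℚ) : ℂ) • cupPowTwo (complexBetti.map (fiberι (toSpecOver P.X) s) 2 h) n +
        complexBetti.map (fiberι (toSpecOver P.X) s) (2 * n) w := by
    rw [map_add, map_smul, complexBetti_map_cupPowTwo]
  have halg := hU s hsU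
  rw [← hres] at halg
  exact (mem_algebraicClasses_map_iff_of_iso (asIso (fiberι (toSpecOver P.X) s))).1 halg

/-- **The local clause makes `w` ALGEBRAIC ON THE ANCHOR** (`n ≥ 1`, `h` rational `(1,1)`, `w` rational `(n,n)`):
`q·hⁿ + w` is algebraic (previous lemma) and `hⁿ` is algebraic on the abelian variety `P` (Lefschetz `(1,1)`,
`lefschetzOneOne_rational_holds`, and Kleiman moving, `cupPowTwo_mem_algebraicClasses_abelian`).
[cite: VoisinHodgeI2002, Thm. 11.30] [cite: VoisinHodgeII2003, §9.2.4 Prop. 9.20] -/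
theorem mem_algebraicClasses_of_weilAnchorLocalClause {n d : ℕ} (hn : 0 < n) {P : AbelianVariety ℂ} {ψ₀ : P ⟶ P}
    (hP : P.dim = 2 * n) (hψ : ψ₀ ≫ ψ₀ = -(d • 𝟙 P)) {h : complexBetti P.X 2} (hhQ : IsRationalClass h)
    (hhH : IsOfHodgeType (2 * n) P.X 2 1 1 h) {w : complexBetti P.X (2 * n)} (hwQ : IsRationalClass w)
    (hwH : IsOfHodgeType (2 * n) P.X (2 * n) n n w) (hloc : WeilAnchorLocalClause n d P h w) :
    w ∈ algebraicClasses P.X n := by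
  obtain ⟨q, hq⟩ :=
    exists_smul_cupPowTwo_add_mem_algebraicClasses_of_weilAnchorLocalClause hP hψ hhQ hhH hwQ hwH hloc
  have hh1 : h ∈ algebraicClasses P.X 1 :=
    lefschetzOneOne_rational_holds (isSmoothProjective_of_dim_eq' hP) _ hhQ hhH
  obtain ⟨m, rfl⟩ : ∃ m, n = m + 1 := ⟨n - 1, by omega⟩
  have hhn : cupPowTwo h (m + 1) ∈ algebraicClasses P.X (m + 1) := cupPowTwo_mem_algebraicClasses_abelian P hh1 m
  have h' := Submodule.sub_mem _ hq (Submodule.smul_mem _ (((q : ℚ) : ℂ)) hhn)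
  rwa [add_sub_cancel_left] at h'

/-- **At the `K`-symmetrised hyperplane class**: for an anchor `(P, ψ₀, e, a, w)` as in
`HasLocallyAlgebraicWeilAnchorInClass` (`n, d ≥ 1`; `h_K = d·e^*a + ψ₀^*e^*a` is rational `(1,1)` by
`isRationalClass_ksymm` / `isOfHodgeType_one_one_ksymm`) the local clause forces `w ∈ algebraicClasses P n`.
[cite: VoisinHodgeI2002, §7.1.2 and Thm. 11.30] -/
theorem mem_algebraicClasses_of_weilAnchorLocalClause_ksymm {n d : ℕ} (hn : 0 < n) (hd : 0 < d)
    {P : AbelianVariety ℂ} {ψ₀ : P ⟶ P} (hP : P.dim = 2 * n) (hψ : ψ₀ ≫ ψ₀ = -(d • 𝟙 P)) (e : ProjectiveEmbedding P.X)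
    {a : complexBetti (projectiveSpace e.n ℂ) 2} (ha : IsRationalClass a) (ha0 : a ≠ 0)
    {w : complexBetti P.X (2 * n)} (hwQ : IsRationalClass w) (hwH : IsOfHodgeType (2 * n) P.X (2 * n) n n w)
    (hloc : WeilAnchorLocalClause n d P
      ((d : ℂ) • complexBetti.map e.ι 2 a + complexBetti.map ψ₀.hom.hom.hom 2 (complexBetti.map e.ι 2 a)) w) :
    w ∈ algebraicClasses P.X n := by
  have hP' : P.dim = (2 * n - 1) + 1 := by omega
  have hH := isOfHodgeType_one_one_ksymm hP' hd ψ₀ e ha ha0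
  rw [show 2 * n - 1 + 1 = 2 * n by omega] at hH
  exact mem_algebraicClasses_of_weilAnchorLocalClause hn hP hψ (isRationalClass_ksymm d ψ₀ e ha) hH hwQ hwH hloc

/-- **What a door-B anchor must be** (necessity, `n, d ≥ 1`): if the cell `(n, d, δ)` has a locally algebraic anchor
and is realisable, then it contains a polarized member `(P, ψ₀, h_K)` ALL of whose Weil classes are algebraic (the
anchor's class `w ≠ 0` is algebraic on `P` by the local clause, and one class suffices,
`weilClassesOf_le_algebraicClasses_iff_exists_ne_zero_of_dim_eq`).  The conclusion alone is met unconditionally by the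
cell's CM member (part 8b `weilClassesComponent_holds_at_cmAnchor`); the content of the node is the deformation
clause AT such a member. [cite: vanGeemen1994HodgeAV, Lemma 5.2 (6) and Thm. 6.12] [cite: Deligne1982HodgeCycles, §5] -/
theorem exists_member_weilClasses_algebraic_of_anchorInClass {n d : ℕ} (hn : 0 < n) (hd : 0 < d)
    {δ : weilNormResidueGroup d} (hA : HasLocallyAlgebraicWeilAnchorInClass n d δ) (hδ : weilSign d δ = (-1) ^ n) :
    ∃ (P : AbelianVariety ℂ) (ψ₀ : P ⟶ P) (e : ProjectiveEmbedding P.X) (a : complexBetti (projectiveSpace e.n ℂ) 2),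
      IsWeilType P ψ₀ n d ∧ IsRationalClass a ∧ a ≠ 0 ∧
      HasWeilDiscriminantNondeg P ψ₀ n d
        ((d : ℂ) • complexBetti.map e.ι 2 a + complexBetti.map ψ₀.hom.hom.hom 2 (complexBetti.map e.ι 2 a)) δ ∧
      weilClassesOf P ψ₀ n d ≤ algebraicClasses P.X n := by
  obtain ⟨P, ψ₀, e, a, w, hP, hψ, ha, ha0, hwW, hwQ, hw0, hwH, hloc, hδP⟩ := hA hδ
  refine ⟨P, ψ₀, e, a, isWeilType_of_weilClass_ne_zero hn hd hP hψ hwW hw0 hwH, ha, ha0, hδP, ?_⟩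
  exact (weilClassesOf_le_algebraicClasses_iff_exists_ne_zero_of_dim_eq abelianVarietyCohomologyExteriorH1_holds
    hP hn hd hψ).2 ⟨w, hwW, mem_algebraicClasses_of_weilAnchorLocalClause_ksymm hn hd hP hψ e ha ha0 hwQ hwH hloc, hw0⟩

end Summit.HodgeConjecture.HodgeConjecture.Ring2.AbelianAll

end
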